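import Summits.AtomisticToContinuum.HydrodynamicLimit.Theses.OneFlightGossipEngine
import Summits.AtomisticToContinuum.HydrodynamicLimit.Theorems.DenseExcursion.Negative.AtTimeZero
import Summits.AtomisticToContinuum.HydrodynamicLimit.Theorems.DenseExcursion.Negative.Untied

/-!
# Negative knowledge for the crux `CollisionActivityTails` — the equilibrium reduction

From the standing disprover's `Cruxes/CollisionActivityTails/Disproof.lean` §5 (cycle 1;
refuter-cdisprove-stmt-AtomisticToContinuum-13734-0; crux stmt-AtomisticToContinuum-13734).  The crux
decl is `Summit.AtomisticToContinuum.HydrodynamicLimit.Theses.OneFlightGossipEngine.CollisionActivityTails`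
(route OneFlightGossipEngine, item #6); route TwoClocks carried the byte-identical copy
`Theses.TwoClocks.CollisionActivityTails` until its rev 10 (2026-08-16) restated it as
`TransferActivityTails` (stmt-AtomisticToContinuum-16624; the port of this reduction to that crux is
`Theorems/TransferActivityTails/Negative/EquilibriumReduction.lean`), so this file now reads the crux
from the OneFlightGossipEngine module (statement of stmt-13734 unchanged).  Nothing here asserts the
crux.

**The crux implies its equilibrium rung, unconditionally**
(`equilibrium_of_crux`): for constant profiles `(a₀, u₀, θ₀)` the hypotheses
of `CollisionActivityTails` are dischargeable in the tree — constant states are classical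
hard-sphere-Euler solutions on every `[0, T)` (`isHardSphereEulerSolution_const`, from
`IsHardSphereEulerSolutionDim.const`), and the `t = 0` law of large numbers of the local Gibbs laws
(`localGibbs_lln_holds`) has, for CONSTANT activity, a CONSTANT limiting density
(`constantProfileLLN_holds`: the hidden `ρ₀` is identified with the exposed witness
`rhoLim (profileOf a₀) σ` of `HardSphereEulerLLN` by uniqueness of limits in probability, and
`rhoLim` is constant because `β` is) — so the crux at `t = 0`, `s = 0` IS the rung
`EquilibriumCollisionActivityTails` (window `(0, w]`, canonical Gibbs law, profile-wise `σ₀`).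
Contrapositive (`not_crux_of_not_equilibrium`): ANY counterexample at global
equilibrium — persistent caging of a tagged sphere with non-vanishing activity-weighted
probability over `τ → ∞` kinetic windows — refutes the crux.  The identification of the LLN
density (`DenseExcursionAtTimeZero.density_zero_eq_rhoLim`) and the constant Euler states
(`DenseExcursionUntied.isHardSphereEulerSolution_const`) are REUSED from the landed negative
knowledge of the crux `DenseExcursion` (imported, not restated).

2026-08-17 repair (route TwoClocks rev 10 removed its copy of the crux decl, full build of
2026-08-17T00:13Z): the three statements naming the crux are restated verbatim against the
OneFlightGossipEngine decl under the new names `equilibrium_of_crux_of_lln`, `equilibrium_of_crux`,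
`not_crux_of_not_equilibrium` (same proofs); the landed names
`equilibriumCollisionActivityTails_of_crux_of_lln`, `equilibriumCollisionActivityTails_of_crux`,
`not_collisionActivityTails_of_not_equilibrium` are kept as deprecated aliases of them (append-only:
deprecate, don't mutate — the pattern of the sibling repair `Negative/Kinematics.lean`).  No other
declaration changed.
-/

noncomputable section

open MeasureTheory Filter Set Topology
open scoped ENNReal

namespace Summit.AtomisticToContinuum.HydrodynamicLimit.Theorems

namespace CollisionActivityTailsEquilibrium

open Literature.MathematicalPhysics.KineticTheory Literature.Analysis.FluidPDE
open DenseExcursionAtTimeZero (density_zero_eq_rhoLim)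
open DenseExcursionUntied (isHardSphereEulerSolution_const)

/-- A hard-sphere flow of `N + 1` spheres of reduced diameter `σ` on `𝕋³` (the crux's `Φ N`). -/
abbrev Flow (σ : ℝ) (N : ℕ) : Type :=
  HardSphereFlow (Torus.geometry (Fin 3)) (hsDiameter σ N) (N + 1)

/-- **Equilibrium activity tails** (the crux's integrand verbatim, at constant profiles, window
`(0, w]`, profile-wise `σ₀`): under the canonical Gibbs law the window activity has vanishing `L¹`
tail above every `V ≥ V₀`, as `τ → ∞` after `N → ∞`. -/
def EquilibriumCollisionActivityTails : Prop :=
  ∀ (a₀ θ₀ : ℝ) (u₀ : V3), 0 < a₀ → 0 < θ₀ → ∃ σ₀ : ℝ, 0 < σ₀ ∧ ∀ σ : ℝ, 0 < σ → σ < σ₀ →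
    ∀ Φ : (N : ℕ) → Flow σ N, ∃ V₀ : ℝ, 0 < V₀ ∧ ∀ V : ℝ, V₀ ≤ V → ∀ ε : ℝ, 0 < ε →
    ∃ τ₀ : ℝ, 0 < τ₀ ∧ ∀ τ : ℝ, τ₀ ≤ τ → ∃ N₀ : ℕ, ∀ N : ℕ, N₀ ≤ N →
      (let w : ℝ := τ * ((N : ℝ) + 1) ^ (-(1 / 3 : ℝ))
       let P := localGibbsLaw σ (fun _ => a₀) (fun _ => u₀) (fun _ => θ₀) N (Φ N)
       let act := fun (i : Fin (N + 1)) (z : Config (N + 1) (Fin 3) T3) =>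
         σ / τ * (Φ N).collisionSum (Set.Ioc 0 w)
           (fun c => if c.fst = i then ‖c.postVel.1 - c.preVel.1‖ else 0) z
       ∫⁻ z, ENNReal.ofReal (((N : ℝ) + 1)⁻¹ *
           ∑ i : Fin (N + 1), Set.indicator {y : ℝ | V < y} (fun y => y) (act i z)) ∂P ≤
         ENNReal.ofReal ε)

/-- **The constant-profile LLN with constant density** (proved below). -/
def ConstantProfileLLN : Prop :=
  ∀ (a₀ θ₀ : ℝ) (u₀ : V3), 0 < a₀ → 0 < θ₀ → ∃ σ₁ : ℝ, 0 < σ₁ ∧ ∀ σ : ℝ, 0 < σ → σ < σ₁ →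
    ∃ r : ℝ, 0 < r ∧ ∀ Φ : (N : ℕ) → Flow σ N,
      TendstoHydroFieldsAt (fun N => localGibbsLaw σ (fun _ => a₀) (fun _ => u₀) (fun _ => θ₀) N (Φ N))
        Φ (fun _ _ => r) (fun _ _ => u₀) (fun _ _ => θ₀) 0

/-- **Reduction (modulo the constant-density LLN)**: the crux implies the equilibrium rung. -/
theorem equilibrium_of_crux_of_lln (hL : ConstantProfileLLN)
    (h : Summit.AtomisticToContinuum.HydrodynamicLimit.Theses.OneFlightGossipEngine.CollisionActivityTails) :
    EquilibriumCollisionActivityTails := by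
  intro a₀ θ₀ u₀ ha hθ
  obtain ⟨σc, hσc, hc⟩ := h (fun _ => a₀) (fun _ => θ₀) (fun _ => u₀) continuous_const
    continuous_const continuous_const (fun _ => ha) (fun _ => hθ)
  obtain ⟨σ₁, hσ₁, hl⟩ := hL a₀ θ₀ u₀ ha hθ
  refine ⟨min σc σ₁, lt_min hσc hσ₁, fun σ hσ hσlt Φ => ?_⟩
  have hσc' : σ < σc := hσlt.trans_le (min_le_left _ _)
  have hσ₁' : σ < σ₁ := hσlt.trans_le (min_le_right _ _)
  obtain ⟨r, hr, hlln⟩ := hl σ hσ hσ₁'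
  obtain ⟨V₀, hV₀, H⟩ := hc σ hσ hσc' 1 (fun _ _ => r) (fun _ _ => θ₀) (fun _ _ => u₀)
    (isHardSphereEulerSolution_const σ 1 u₀ hr hθ) Φ (hlln Φ) 0 ⟨le_rfl, one_pos⟩
  refine ⟨V₀, hV₀, fun V hV ε hε => ?_⟩
  obtain ⟨τ₀, hτ₀, H⟩ := H V hV ε hε
  refine ⟨τ₀, hτ₀, fun τ hτ => ?_⟩
  obtain ⟨N₀, H⟩ := H τ hτ
  refine ⟨N₀, fun N hN => ?_⟩
  have key := H N hN 0 ⟨le_rfl, le_rfl⟩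
  simpa only [zero_add] using key

/-- Former name of `equilibrium_of_crux_of_lln`, stated through the TwoClocks copy of the crux
(`Theses.TwoClocks.CollisionActivityTails`, removed by route TwoClocks rev 10 on 2026-08-16); the
statement of stmt-13734 is unchanged and is now read from route OneFlightGossipEngine. -/
@[deprecated equilibrium_of_crux_of_lln (since := "2026-08-17")]
alias equilibriumCollisionActivityTails_of_crux_of_lln := equilibrium_of_crux_of_lln

section ConstantLLN

/-- For a CONSTANT activity the pinned density `rhoLim` is a constant function (`β` is constant). -/
theorem rhoLim_const {a : ℝ} (ha : 0 < a) (σ : ℝ) (x y : T3) :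
    rhoLim (profileOf (fun _ : T3 => a) continuous_const (fun _ => ha)) σ x =
      rhoLim (profileOf (fun _ : T3 => a) continuous_const (fun _ => ha)) σ y := by
  simp only [rhoLim, profileOf_β]

/-- Flow families exist at every reduced density `0 < σ < 1/2` (Alexander's theorem on `𝕋³`). -/
theorem flows_nonempty {σ : ℝ} (hσ : 0 < σ) (hσ2 : σ < 1 / 2) : Nonempty ((N : ℕ) → Flow σ N) :=
  ⟨fun N => Classical.choice (HardSphereFlow.nonempty_torus_holds (d := Fin 3)
    (hsDiameter_pos hσ N) ((hsDiameter_le hσ.le N).trans_lt (hσ2.trans_eq (by norm_num)))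
    (N + 1))⟩

/-- **The constant-profile LLN has a constant density**: `ConstantProfileLLN` holds (the hidden
`ρ₀` of `localGibbs_lln_holds` is pinned to `rhoLim`, which is constant for constant activity). -/
theorem constantProfileLLN_holds : ConstantProfileLLN := by
  intro a θ u ha hθ
  obtain ⟨σa, hσa, Ha⟩ := localGibbs_lln_holds (fun _ => a) (fun _ => θ) (fun _ => u)
    continuous_const continuous_const continuous_const (fun _ => ha) (fun _ => hθ)
  obtain ⟨σb, hσb, hσb2, Hb⟩ := density_zero_eq_rhoLim (a₀ := fun _ : T3 => a) (θ₀ := fun _ => θ)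
    (u₀ := fun _ => u) continuous_const continuous_const continuous_const (fun _ => ha)
    (fun _ => hθ)
  refine ⟨min σa σb, lt_min hσa hσb, fun σ hσ hσlt => ?_⟩
  have hσa' : σ < σa := hσlt.trans_le (min_le_left _ _)
  have hσb' : σ < σb := hσlt.trans_le (min_le_right _ _)
  have hσ2 : σ < 1 / 2 := hσb'.trans_le hσb2
  set P := profileOf (fun _ : T3 => a) continuous_const (fun _ => ha) with hP
  obtain ⟨h, hpin⟩ := Hb σ hσ hσb'
  obtain ⟨ρ₀, hρc, hρpos, Hlln⟩ := Ha σ hσ hσa'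
  obtain ⟨Φ⟩ := flows_nonempty hσ hσ2
  -- pin the hidden density along SOME flow family, then use constancy of `rhoLim`
  have hid : ρ₀ = rhoLim P σ :=
    hpin (fun _ => ρ₀) (fun _ _ => θ) (fun _ _ => u) Φ hρc (Hlln Φ).2
  have hconst : rhoLim P σ = fun _ => ρ₀ 0 := by
    funext x
    rw [hid]
    exact rhoLim_const ha σ x 0
  refine ⟨ρ₀ 0, hρpos 0, fun Ψ => ?_⟩
  have hT := (Hlln Ψ).2
  rw [hid, hconst] at hT
  exact hT

end ConstantLLN

/-- **The reduction is unconditional**: the crux implies the equilibrium rung. -/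
theorem equilibrium_of_crux
    (h : Summit.AtomisticToContinuum.HydrodynamicLimit.Theses.OneFlightGossipEngine.CollisionActivityTails) :
    EquilibriumCollisionActivityTails :=
  equilibrium_of_crux_of_lln constantProfileLLN_holds h

/-- Former name of `equilibrium_of_crux`, stated through the removed TwoClocks copy of the crux. -/
@[deprecated equilibrium_of_crux (since := "2026-08-17")]
alias equilibriumCollisionActivityTails_of_crux := equilibrium_of_crux

/-- Contrapositive: **any counterexample to the equilibrium rung refutes the crux.** -/
theorem not_crux_of_not_equilibrium (h : ¬ EquilibriumCollisionActivityTails) :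
    ¬ Summit.AtomisticToContinuum.HydrodynamicLimit.Theses.OneFlightGossipEngine.CollisionActivityTails :=
  fun hc => h (equilibrium_of_crux hc)

/-- Former name of `not_crux_of_not_equilibrium`, stated through the removed TwoClocks copy of the
crux. -/
@[deprecated not_crux_of_not_equilibrium (since := "2026-08-17")]
alias not_collisionActivityTails_of_not_equilibrium := not_crux_of_not_equilibrium

end CollisionActivityTailsEquilibrium

end Summit.AtomisticToContinuum.HydrodynamicLimit.Theorems
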